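import Summits.QuantumAdvantage.QuantumAdvantage.Theses.CubicForrelation
import Summits.QuantumAdvantage.QuantumAdvantage.Theorems.CubicForrelationSignedExactCubicForrelationNotPrBPPStubSignReadout
import Summits.QuantumAdvantage.QuantumAdvantage.Theorems.CubicForrelationSignedExactCubicForrelationNotPrBPPStubPlumbing
import Summits.QuantumAdvantage.QuantumAdvantage.Theorems.CubicForrelationSignedExactCubicForrelationNotPrBPPFinderMachine
import Summits.QuantumAdvantage.QuantumAdvantage.Theorems.CubicForrelationSignedExactCubicForrelationInPrBPPOfFinder

/-!
# Crux `CubicForrelation.SignedExactCubicForrelationNotPrBPP` (stmt-QuantumAdvantage-13932): NEGATIVE LEMMA modulo `PairFinderExact`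

Line `dual-pingpong-frame` (lead prover, 2026-08-16). The crux says that the SIGNED EXACT slice of cubic 2-fold
Forrelation (`signedExactCubicForrelationProblem 2`: YES `Φ = 1`, NO `Φ = -1`, `k = 2`, `n` even, `B₂`-circuits of
𝔽₂-degree `≤ 3`) is NOT in `PromiseBPP'`. This file isolates the single open hypothesis of the line's refutation:

* `PairFinderExact` — a polynomial-time FUNCTION that, on (the code of) every exact cubic two-circuit instance, outputs rows
  spanning a half-dimensional M-subspace of the second function (an `FP` worst-case M-subspace FINDER; for
  Maiorana–McFarland-orbit pairs = the ping-pong finder `PairFinderMM` of the line, made total on the exact slice by crux r5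
  `ExactPairsMaioranaMcFarland`). OPEN: no uniform running-time theorem is known for any finder, although every planted
  family tried (`n ≤ 96`, > 600 instances, four implementations) is solved with 0 wrong signs.
* `SignedExactCubicForrelationNotPrBPP_false_of_PairFinderExact` — `PairFinderExact → ¬ crux`, from the two LANDED stubs of
  the line: the sign readout `stub_signReadout` (`Φ = (-1)^{a(0)}(-1)^{b(μ)}` from one M-subspace and the dual slope; Poisson
  summation = `DerivativeWalsh.coset_sum_eq_of_forrelation_eq_one/neg_one`) and the deterministic `FP` decider
  `stub_plumbing` (rows ↦ kernel basis ↦ slope `μ` ↦ accept iff `a(0) = b(μ)`, wrapped by `mem_PromiseBPP'_of_fp_decider`).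

So ALL remaining content of `¬ crux` is the construction of `PairFinderExact` (a construction/definition item in the sense
of the negative-lemma protocol); conversely the crux implies that no such finder exists.
-/

noncomputable section

set_option linter.dupNamespace false -- D-0017: single-problem summit ⇒ `QuantumAdvantage.QuantumAdvantage` by design

namespace Summit.QuantumAdvantage.QuantumAdvantage.Theorems.SignedExactCubicForrelationNotPrBPP.Negative

open Finset
open Literature.Computability.Complexity Literature.Computability.QuantumComplexity
open Literature.Computability.QuantumComplexity.BuzetChailloux (bxor zeroVec)

/-- **`PairFinderExact` — a worst-case polynomial-time M-subspace finder for exact cubic pairs** (the OPEN hypothesis).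
There is a string function `find ∈ FP` such that for every two-circuit instance `I` (`k = 2`, `n` even, `B₂`-circuits, both
computed functions of 𝔽₂-degree `≤ 3`) with `Φ = ±1`, `find (encode I)` is the register code `encList L` of rows `L` whose
𝔽₂-row span `V` (read back as bit vectors) is a half-dimensional M-subspace of the second function `g = C₁`: `0 ∈ V`, `V`
closed under `⊕`, `|V|² = 2ⁿ`, and every second difference `g(x) ⊕ g(x⊕u) ⊕ g(x⊕v) ⊕ g(x⊕u⊕v)` (`u, v ∈ V`) vanishes
(Dillon's criterion for the completed Maiorana–McFarland class, Carlet 2020 Prop. 54). Verbatim the first hypothesis of the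
landed `stub_plumbing`. NOT a published result and not a route item: the line's conjectural algorithmic content (ping-pong /
algebra-orbit closure on the two cubic tensors), isolated here as the construction `H` of the negative-lemma protocol so that
the lemma below has exactly one hypothesis. -/
def PairFinderExact : Prop :=
  ∃ find ∈ FP, ∀ (I : KForrelationInstance) (hk : I.k = 2), Even I.n → I.IsOverB2 →
    (∀ i, IsDegLeFun 3 (I.C i).eval) → (I.value = 1 ∨ I.value = -1) →
    ∃ L : List (List Bool), find I.encode = encList L ∧
      ((zeroVec ∈ (@Finset.filter (Fin (I.n) → Bool) (fun v => (fun i => if v i then (1 : ZMod 2) else 0) ∈ F2Elim.rowSpan (I.n) L) (Classical.decPred _) Finset.univ) ∧ ∀ x ∈ (@Finset.filter (Fin (I.n) → Bool) (fun v => (fun i => if v i then (1 : ZMod 2) else 0) ∈ F2Elim.rowSpan (I.n) L) (Classical.decPred _) Finset.univ), ∀ y ∈ (@Finset.filter (Fin (I.n) → Bool) (fun v => (fun i => if v i then (1 : ZMod 2) else 0) ∈ F2Elim.rowSpan (I.n) L) (Classical.decPred _) Finset.univ), bxor x y ∈ (@Finset.filter (Fin (I.n) → Bool) (fun v => (fun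 i => if v i then (1 : ZMod 2) else 0) ∈ F2Elim.rowSpan (I.n) L) (Classical.decPred _) Finset.univ)) ∧ ((((@Finset.filter (Fin (I.n) → Bool) (fun v => (fun i => if v i then (1 : ZMod 2) else 0) ∈ F2Elim.rowSpan (I.n) L) (Classical.decPred _) Finset.univ)).card : ℝ) ^ 2 = (2 : ℝ) ^ (I.n)) ∧ (∀ u ∈ (@Finset.filter (Fin (I.n) → Bool) (fun v => (fun i => if v i then (1 : ZMod 2) else 0) ∈ F2Elim.rowSpan (I.n) L) (Classical.decPred _) Finset.univ), ∀ v ∈ (@Finset.filter (Fin (I.n) → Bool) (fun v => (fun i => if v i then (1 : ZMod 2) else 0) ∈ F2Elim.rowSpan (I.n) L) (Classical.decPred _) Finset.univ), ∀ x, ((I.C (Fin.cast hk.symm 1)).eval x ^^ (I.C (Fin.cast hk.symm 1)).eval (bxor x u) ^^ (I.C (Fin.cast hk.symm 1)).eval (bxor x v) ^^ (I.C (Fin.cast hk.symm 1)).eval (bxor x (bxor u v))) = false))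

/-- **NEGATIVE LEMMA.** A worst-case polynomial-time M-subspace finder for exact cubic pairs refutes the crux
`SignedExactCubicForrelationNotPrBPP` (stmt-QuantumAdvantage-13932): feed the finder and the landed sign readout
`stub_signReadout` to the landed decider `stub_plumbing`, obtaining `signedExactCubicForrelationProblem 2 ∈ PromiseBPP'`, which
is literally the negation of the crux (`signedExactCubicForrelationProblem_two_eq`, `rfl`). [folklore] -/
theorem SignedExactCubicForrelationNotPrBPP_false_of_PairFinderExact :
    PairFinderExact →
      ¬ Summit.QuantumAdvantage.QuantumAdvantage.Theses.CubicForrelation.SignedExactCubicForrelationNotPrBPP := by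
  intro H hcrux
  apply hcrux
  show signedExactCubicForrelationProblem 2 ∈ PromiseBPP'
  exact Summit.QuantumAdvantage.QuantumAdvantage.Theorems.SignedExactCubicForrelationNotPrBPP.stub_plumbing H
    Summit.QuantumAdvantage.QuantumAdvantage.Theorems.SignedExactCubicForrelationNotPrBPP.stub_signReadout

/-! ### Appended 2026-08-16 (lead, cycle 2): `PairFinderExact` from the COMPLETENESS of the landed machine `findV2` and crux r5 -/

/-- **`PairFinderExact` from completeness of `findV2` and crux r5.** If the landed finder machine
`FinderMachine.findV2` (`findV2_mem_FP`, `findV2_sound`, p94496) outputs a NON-EMPTY row list on every two-circuit instance over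
`B₂` with both functions cubic, `Φ = ±1`, and second function on a completed Maiorana–McFarland orbit (the one open stub
`stub_finderComplete` of the line `dual-pingpong-frame`, here the first hypothesis, verbatim), and if every exactly forrelated cubic
pair is of that shape (route item `ExactPairsMaioranaMcFarland`, stmt-QuantumAdvantage-2205, by name; applied to `(f,g)` when
`Φ = 1` and to `(¬f, g)` when `Φ = -1`), then `PairFinderExact` holds — hence, with the negative lemma above, the crux is false.
[folklore] -/
theorem pairFinderExact_of_complete
    (hC : ∀ (m : ℕ) (C : Fin 2 → Circuit (Fin (m + m))),
    (⟨m + m, 2, C⟩ : KForrelationInstance).IsOverB2 →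
    (∀ i, IsDegLeFun 3 (C i).eval) →
    (forrelation (C 0).eval (C 1).eval = 1 ∨ forrelation (C 0).eval (C 1).eval = -1) →
    (∃ e : (Fin (m + m) → Bool) ≃ (Fin (m + m) → Bool),
      (∃ M : Matrix (Fin (m + m)) (Fin (m + m)) (ZMod 2), ∃ c : Fin (m + m) → ZMod 2,
        ∀ y i, (if e y i then (1 : ZMod 2) else 0) = (M.mulVec (fun j => if y j then (1 : ZMod 2) else 0) + c) i) ∧
      ∃ perm : (Fin m → Bool) ≃ (Fin m → Bool), ∃ h : (Fin m → Bool) → Bool, ∀ y' y'' : Fin m → Bool,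
        (if (C 1).eval (e (Fin.append y' y'')) then (1 : ZMod 2) else 0) =
          (∑ i, (if y' i then (1 : ZMod 2) else 0) * (if perm y'' i then (1 : ZMod 2) else 0)) +
            (if h y'' then (1 : ZMod 2) else 0)) →
    ∃ L : List (List Bool), L ≠ [] ∧
      Summit.QuantumAdvantage.QuantumAdvantage.Theorems.SignedExactCubicForrelationNotPrBPP.FinderMachine.findV2
        (KForrelationInstance.encode ⟨m + m, 2, C⟩) = encList L)
    (h5 : Summit.QuantumAdvantage.QuantumAdvantage.Theses.CubicForrelation.ExactPairsMaioranaMcFarland) :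
    PairFinderExact := by
  refine ⟨Summit.QuantumAdvantage.QuantumAdvantage.Theorems.SignedExactCubicForrelationNotPrBPP.FinderMachine.findV2,
    Summit.QuantumAdvantage.QuantumAdvantage.Theorems.SignedExactCubicForrelationNotPrBPP.FinderMachine.findV2_mem_FP, ?_⟩
  rintro ⟨n, k, C⟩ hk heven hB hdeg hv
  dsimp only at hk heven hB hdeg hv ⊢
  subst hk
  obtain ⟨m, rfl⟩ := heven
  rw [KForrelationInstance.value_mk_two] at hv
  have key : ∀ (hmm : _), ∃ L : List (List Bool),
      Summit.QuantumAdvantage.QuantumAdvantage.Theorems.SignedExactCubicForrelationNotPrBPP.FinderMachine.findV2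
        (KForrelationInstance.encode ⟨m + m, 2, C⟩) = encList L ∧ _ :=
    fun hmm => by
      obtain ⟨L, hL, hfind⟩ := hC m C hB hdeg hv hmm
      exact ⟨L, hfind, Summit.QuantumAdvantage.QuantumAdvantage.Theorems.SignedExactCubicForrelationNotPrBPP.FinderMachine.findV2_sound
        ⟨m + m, 2, C⟩ rfl L hdeg hfind hL⟩
  rcases hv with h | h
  · exact key (h5 m _ _ (hdeg 0) (hdeg 1) h)
  · refine key (h5 m (fun x => !(C 0).eval x) _ (hdeg 0).not (hdeg 1) ?_)
    rw [Summit.QuantumAdvantage.QuantumAdvantage.Theorems.SignedExactCubicForrelationInPrBPP.forrelation_not_left, h, neg_neg]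

/-- **The crux is false under completeness of `findV2` and r5** (composition of the two theorems above). [folklore] -/
theorem SignedExactCubicForrelationNotPrBPP_false_of_complete
    (hC : ∀ (m : ℕ) (C : Fin 2 → Circuit (Fin (m + m))),
    (⟨m + m, 2, C⟩ : KForrelationInstance).IsOverB2 →
    (∀ i, IsDegLeFun 3 (C i).eval) →
    (forrelation (C 0).eval (C 1).eval = 1 ∨ forrelation (C 0).eval (C 1).eval = -1) →
    (∃ e : (Fin (m + m) → Bool) ≃ (Fin (m + m) → Bool),
      (∃ M : Matrix (Fin (m + m)) (Fin (m + m)) (ZMod 2), ∃ c : Fin (m + m) → ZMod 2,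
        ∀ y i, (if e y i then (1 : ZMod 2) else 0) = (M.mulVec (fun j => if y j then (1 : ZMod 2) else 0) + c) i) ∧
      ∃ perm : (Fin m → Bool) ≃ (Fin m → Bool), ∃ h : (Fin m → Bool) → Bool, ∀ y' y'' : Fin m → Bool,
        (if (C 1).eval (e (Fin.append y' y'')) then (1 : ZMod 2) else 0) =
          (∑ i, (if y' i then (1 : ZMod 2) else 0) * (if perm y'' i then (1 : ZMod 2) else 0)) +
            (if h y'' then (1 : ZMod 2) else 0)) →
    ∃ L : List (List Bool), L ≠ [] ∧
      Summit.QuantumAdvantage.QuantumAdvantage.Theorems.SignedExactCubicForrelationNotPrBPP.FinderMachine.findV2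
        (KForrelationInstance.encode ⟨m + m, 2, C⟩) = encList L)
    (h5 : Summit.QuantumAdvantage.QuantumAdvantage.Theses.CubicForrelation.ExactPairsMaioranaMcFarland) :
    ¬ Summit.QuantumAdvantage.QuantumAdvantage.Theses.CubicForrelation.SignedExactCubicForrelationNotPrBPP :=
  SignedExactCubicForrelationNotPrBPP_false_of_PairFinderExact (pairFinderExact_of_complete hC h5)

end Summit.QuantumAdvantage.QuantumAdvantage.Theorems.SignedExactCubicForrelationNotPrBPP.Negative

end
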